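import Summits.BirchSwinnertonDyer.Rank1Residual.ManinAdditive.ShimuraKernel
import Literature.NumberTheory.EllipticCurves.ModularCurveManinSemistableLatticeFormProofs
import Literature.NumberTheory.EllipticCurves.QuadraticTwistAtTwoMinimalModelProofs
import Literature.NumberTheory.EllipticCurves.LFunctionSmulProofs
import Literature.NumberTheory.EllipticCurves.SzpiroLocalDataProofs
import Literature.NumberTheory.EllipticCurves.DegreeConjectureAbcPrelims
import Literature.NumberTheory.EllipticCurves.GlobalMinimalModelProofs
import Literature.NumberTheory.EllipticCurves.CuspFormLFunctionLevelConductorProofs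
import HarnessLib

/-!
# The WLOG `a₁ = a₃ = 0` edge of the C2 kernel road: `body_of_normalised`
# (route `ManinLocalTwoThree`, crux C2 `ManinOddAtFour` stmt-BirchSwinnertonDyer-22967; cell bsd-f2-manin — ref1 §R136 «WLOG edge: MISSING-IN-TREE
# (sound; typed signature)», an MEMO §76.12; p3 gen 12)

The kernel road (`ShimuraKernel.maninOdd_of_kernel_rows_of_gammaOneOddAtFour`) concludes `2 ∤ c` only for globally minimal models with
`a₁ = a₃ = 0`.  This file supplies the plumbing edge to the universal body of C2 (`ShimuraKernel.ManinOddAtFourBody`):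
* §1 `even_a₁_even_a₃_of_sq_dvd_conductorNorm`: `4 ∣ N(W)` and `W` globally minimal ⟹ the integral model has `a₁`, `a₃` even
  (`a₁` odd ⟹ `c₄` odd; `a₁` even, `a₃` odd ⟹ `Δ` odd — either way `W` would be semistable at `2`);
* §2 `exists_normalised_smul`: the change `(u, r, s, t) = (1, 0, −a₁/2, −a₃/2)` is integral with `u = 1`, so `W₀ := C • W` is again globally
  minimal (`IsMinimal.smul_baseChange` at every place), has `a₁ = a₃ = 0`, the same `c₄, c₆`, hence the same Néron lattices, and the same newform;
* §3 **`body_of_normalised`**: a lattice-optimal `X₀(N)`-datum `D` of `W` is REBUILT on `W₀` from its arithmetic content `(f, Λ, c)`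
  (`ModularParametrizationData.exists_of_isNewformOf`) — no transport of uniformisations is needed —, so the normalised statement gives
  `2 ∤ c(D)`.
HONEST FRAMING: E-blind plumbing (Silverman VII.1, VIII.8); no conjecture content; nothing about BSD or Manin's conjecture is proved; C2 OPEN.
[cite: SilvermanAEC2009, VII.1 Prop. 1.3 and VIII.8 (global minimal models), III.1 Table 3.1] [cite: Stevens1989, §1 (the datum (f, Λ_E, c))]
-/

set_option autoImplicit false
-- lint-debt: the directory name repeats the summit name (sibling precedent `ManinLocalTwoThreeNegOneTwistConductorAtTwo.lean`)
set_option linter.dupNamespace false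

noncomputable section

open scoped Classical NumberField
open WeierstrassCurve IsDedekindDomain IsDedekindDomain.HeightOneSpectrum Rat.HeightOneSpectrum
  Literature.NumberTheory.EllipticCurves Literature.NumberTheory.EllipticCurves.ModularForms
  Summit.BirchSwinnertonDyer.Rank1Residual.ManinAdditive.ShimuraKernel

namespace Summit.BirchSwinnertonDyer.BirchSwinnertonDyer.Theorems.ManinLocalTwoThree

/-! ## §1 `4 ∣ N` forces `a₁`, `a₃` even on the global minimal model -/

/-- **`4 ∣ N(W)` ⟹ `a₁` and `a₃` of the integral global minimal model are even.** [cite: SilvermanAEC2009, VII.5 Prop. 5.1 and III.1] -/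
theorem even_a₁_even_a₃_of_sq_dvd_conductorNorm (W : WeierstrassCurve ℚ) [W.IsElliptic] [W.IsGloballyMinimal]
    (h4 : 2 ^ 2 ∣ W.conductorNorm ℤ) : Even (integralModelInt W).a₁ ∧ Even (integralModelInt W).a₃ := by
  set M : WeierstrassCurve ℤ := integralModelInt W with hM
  have hWM : M.baseChange ℚ = W := map_integralModelInt W
  haveI : (M.baseChange ℚ).IsElliptic := by rw [hWM]; infer_instance
  set vZ : HeightOneSpectrum ℤ := (primesEquiv (R := ℤ)).symm ⟨2, Nat.prime_two⟩ with hvZ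
  have hgen : natGenerator vZ = 2 := Literature.NumberTheory.EllipticCurves.Rat.natGenerator_primesEquiv_symm ⟨2, Nat.prime_two⟩
  set v : HeightOneSpectrum (𝓞 ℚ) := (primesEquiv (R := 𝓞 ℚ)).symm ⟨2, Nat.prime_two⟩ with hv
  have hpv : primesEquiv v = ⟨2, Nat.prime_two⟩ := (primesEquiv (R := 𝓞 ℚ)).apply_symm_apply _
  have hminZ : (M.baseChange ℚ).IsMinimalAt vZ := by
    rw [hWM]
    refine (isMinimalAt_iff_of_primesEquiv_eq v vZ W ?_).mp (IsGloballyMinimal.isMinimal v)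
    rw [hpv, hvZ, Equiv.apply_symm_apply]
  -- `f₂ ≥ 2`, i.e. additive at `2`: `2 ∣ Δ(M)` and `2 ∣ c₄(M)`
  have hf2 : 2 ≤ (M.baseChange ℚ).conductorExponent vZ := by
    rw [hWM, hvZ, ← factorization_conductorNorm_primesEquiv_symm W ⟨2, Nat.prime_two⟩]
    exact (Nat.prime_two.pow_dvd_iff_le_factorization (W.conductorNorm_pos_holds).ne').mp h4
  have hadd := ((M.baseChange ℚ).two_le_conductorExponent_iff_holds vZ).mp hf2
  obtain ⟨hΔ, hc₄⟩ := (hasAdditiveReductionAt_iff_of_isMinimalAt hminZ).mp hadd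
  rw [baseChange_int_Δ, Literature.NumberTheory.EllipticCurves.Rat.valuation_intCast_lt_one_iff vZ, hgen] at hΔ
  rw [baseChange_int_c₄, Literature.NumberTheory.EllipticCurves.Rat.valuation_intCast_lt_one_iff vZ, hgen] at hc₄
  have h₁ : Even M.a₁ := by
    by_contra h
    exact odd_c₄_of_odd_a₁ M (Int.not_even_iff_odd.mp h) (by exact_mod_cast hc₄)
  refine ⟨h₁, ?_⟩
  by_contra h
  exact odd_Δ_of_even_a₁_of_odd_a₃ M h₁ (Int.not_even_iff_odd.mp h) (by exact_mod_cast hΔ)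

/-! ## §2 The normalising change of variables -/

/-- **The normalised global minimal model.**  If `a₁`, `a₃` of the integral global minimal model are even, then
`C = (1, 0, −a₁/2, −a₃/2) • W` is globally minimal with `a₁ = a₃ = 0` and the same `c₄`, `c₆`.
[cite: SilvermanAEC2009, VII.1 Prop. 1.3(b), VIII.8 and III.1 Table 3.1] -/
theorem exists_normalised_smul (W : WeierstrassCurve ℚ) [W.IsElliptic] [W.IsGloballyMinimal]
    (h : Even (integralModelInt W).a₁ ∧ Even (integralModelInt W).a₃) :
    ∃ C : VariableChange ℚ, (C • W).a₁ = 0 ∧ (C • W).a₃ = 0 ∧ (C • W).c₄ = W.c₄ ∧ (C • W).c₆ = W.c₆ ∧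
      (C • W).IsGloballyMinimal := by
  set M : WeierstrassCurve ℤ := integralModelInt W with hM
  have hWM : M.baseChange ℚ = W := map_integralModelInt W
  obtain ⟨⟨s₀, hs₀⟩, ⟨t₀, ht₀⟩⟩ := h
  set C : VariableChange ℚ := ⟨1, 0, -(s₀ : ℚ), -(t₀ : ℚ)⟩ with hC
  have ha₁ : W.a₁ = (s₀ : ℚ) + s₀ := by rw [← hWM]; simp [WeierstrassCurve.baseChange, hs₀]
  have ha₃ : W.a₃ = (t₀ : ℚ) + t₀ := by rw [← hWM]; simp [WeierstrassCurve.baseChange, ht₀]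
  refine ⟨C, ?_, ?_, ?_, ?_, ?_⟩
  · rw [hC, variableChange_a₁]; simp [ha₁]; ring
  · rw [hC, variableChange_a₃]; simp [ha₃]; ring
  · rw [hC, variableChange_c₄]; simp
  · rw [hC, variableChange_c₆]; simp
  · refine isGloballyMinimal_of_forall_isMinimalAt_int (C • W) fun v ↦ ?_
    -- at each place: `(C • W) ⊗ K_v = D_v • (W ⊗ K_v)` with `D_v` integral, `u = 1`
    set v' : HeightOneSpectrum (𝓞 ℚ) := (primesEquiv (R := 𝓞 ℚ)).symm (primesEquiv v) with hv'
    have hmin : W.IsMinimalAt v := by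
      refine (isMinimalAt_iff_of_primesEquiv_eq v' v W ?_).mp (IsGloballyMinimal.isMinimal v')
      rw [hv', Equiv.apply_symm_apply]
    haveI : (W.baseChange (v.adicCompletion ℚ)).IsMinimal (v.adicCompletionIntegers ℚ) := hmin
    set D : VariableChange (v.adicCompletionIntegers ℚ) := ⟨1, 0, -((s₀ : ℤ) : v.adicCompletionIntegers ℚ),
      -((t₀ : ℤ) : v.adicCompletionIntegers ℚ)⟩ with hD
    have key := IsMinimal.smul_baseChange (R := v.adicCompletionIntegers ℚ) (W.baseChange (v.adicCompletion ℚ)) D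
    have hDC : D.baseChange (v.adicCompletion ℚ) • W.baseChange (v.adicCompletion ℚ) = (C • W).baseChange (v.adicCompletion ℚ) := by
      rw [WeierstrassCurve.baseChange, WeierstrassCurve.baseChange, ← map_variableChange]
      congr 1
      rw [hD, hC]
      ext <;> simp [VariableChange.baseChange, VariableChange.map]
    change ((C • W).baseChange (v.adicCompletion ℚ)).IsMinimal (v.adicCompletionIntegers ℚ)
    rw [← hDC]; exact key

/-! ## §3 The edge -/

/-- **`body_of_normalised` (ref1 §R136 typed signature): the universal body of C2 follows from its restriction to globally minimal models
with `a₁ = a₃ = 0`** (granted the Modularity Theorem in the form `exists_isNewformOf`, for `N = N(W)`).  The datum is rebuilt on the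
normalised model from `(f, Λ, c)` by `ModularParametrizationData.exists_of_isNewformOf`.
[cite: SilvermanAEC2009, VII.1 Prop. 1.3(b) and VIII.8] [cite: Stevens1989, §1] -/
theorem body_of_normalised (hnf : exists_isNewformOf)
    (h : ∀ (W₀ : WeierstrassCurve ℚ) [W₀.IsElliptic] [W₀.IsGloballyMinimal] {N : ℕ} [NeZero N] (D₀ : ModularParametrizationData W₀ N),
      (∀ z ∈ D₀.L.lattice, ∃ w ∈ periodLattice D₀.f, z = D₀.c * w) → 2 ^ 2 ∣ N → W₀.a₁ = 0 → W₀.a₃ = 0 →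
      ¬ (2 : ℤ) ∣ D₀.maninConstant) :
    ManinOddAtFourBody := by
  intro W _ _ N _ D hopt h4
  have hN : N = W.conductorNorm ℤ := IsNewformOf.level_eq_conductorNorm_of_exists_isNewformOf hnf D.isNewformOf
  obtain ⟨C, ha₁, ha₃, hc₄, hc₆, hmin⟩ :=
    exists_normalised_smul W (even_a₁_even_a₃_of_sq_dvd_conductorNorm W (by rw [← hN]; exact_mod_cast h4))
  haveI := hmin
  -- the arithmetic content `(f, Λ, c)` of `D`, read on `C • W`
  have hf : IsNewformOf (C • W) D.f := by
    have := D.isNewformOf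
    simp only [IsNewformOf, WeierstrassCurve.LFunction_smul] at this ⊢
    exact this
  have hL : IsNeronLatticeOf ((C • W).baseChange ℂ) D.L := by
    obtain ⟨h2, h3⟩ := D.isNeronLattice
    refine ⟨?_, ?_⟩
    · rw [h2, WeierstrassCurve.baseChange, WeierstrassCurve.baseChange, map_c₄, map_c₄, hc₄]
    · rw [h3, WeierstrassCurve.baseChange, WeierstrassCurve.baseChange, map_c₆, map_c₆, hc₆]
  have hc0 : D.c ≠ 0 := by
    intro h0
    obtain ⟨w, -, hw⟩ := hopt D.L.ω₁ D.L.ω₁_mem_lattice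
    rw [h0, Int.cast_zero, zero_mul] at hw
    exact (LinearIndependent.ne_zero 0 D.L.indep) (by simpa using hw)
  obtain ⟨D₀, hf₀, hL₀, hc₀⟩ := ModularParametrizationData.exists_of_isNewformOf hf hL hc0 D.smul_periodLattice_le
  have key := h (C • W) D₀ (by rw [hL₀, hf₀, hc₀]; exact hopt) h4 ha₁ ha₃
  rw [ModularParametrizationData.maninConstant] at key ⊢
  rwa [hc₀] at key

end Summit.BirchSwinnertonDyer.BirchSwinnertonDyer.Theorems.ManinLocalTwoThree

end
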